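import Mathlib.Geometry.Manifold.SmoothEmbedding
import Mathlib.Geometry.Manifold.Instances.Real
import Mathlib.Geometry.Manifold.IsManifold.InteriorBoundary
import Mathlib.Geometry.Manifold.Diffeomorph
import Literature.Topology.FourManifolds.Cobordism
import Literature.Topology.FourManifolds.Isotopy
import HarnessLib

-- provenance: harness21/H21/H21/Prelude/FourManL/Gluing.lean @ 585521a (interim HEAD d8f2665); M5 mechanical rewrite
/-!
# Collars and gluing of manifolds along their boundary (trunk T-4MAN, prelude `FourManL`)

Notions `gluing_along_boundary` and `manifold_boundary_as_manifold` of the G24 outline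
(`H21/Outlines/FourManL.md`, §C1, Design 3, the "L half" complementing the accepted G18 files
`Literature.Prelude.FourManM.Cobordism` (`BoundaryData`, `Cobordism`) and
`Literature.Prelude.FourManM.ConnectedSum` (`IsOpenGluing`)).

## Informal content

* **Collars.** If `M` is a smooth manifold with boundary, `∂M` has a *collar*: a smooth
  embedding `c : ∂M × [0, 1) ↪ M` onto an open neighbourhood of `∂M` with `c (x, 0) = x`
  (M. Brown, *Locally flat imbeddings of topological manifolds*, Ann. Math. 75 (1962) — TOP;
  Hirsch, *Differential Topology* (1976), Thm. 4.6.1; Milnor, *Lectures on the h-cobordism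
  theorem* (1965), §1). We use the closed collar `∂M × [0, 1]` (restrict a collar of width `2`),
  whose source `b.carrier × Set.Icc 0 1` carries Mathlib's product model `I₀.prod (𝓡∂ 1)` — the
  model G18 already uses in `Cobordism.IsTrivial`.
* **Gluing along the boundary.** Given smooth manifolds with boundary `M`, `N` and a
  diffeomorphism `φ : ∂M ≅ ∂N`, there is a smooth closed manifold `P = M ∪_φ N` containing `M` and
  `N` as smooth codimension-`0` submanifolds meeting exactly along `∂M ≡_φ ∂N`; `P` is unique up to
  diffeomorphism and depends only on the isotopy class of `φ` (Hirsch (1976), §8.2,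
  Thms. 8.2.1–8.2.2; Bröcker–Jänich, *Introduction to Differential Topology* (1982), §13; Milnor
  (1965), §1 (gluing cobordisms, Thm. 1.4)). The *double* of `M` is `M ∪_{id} M`.

## Mathlib

Mathlib has smooth embeddings `Manifold.IsSmoothEmbedding I J n f` (`SmoothEmbedding.lean`:
an immersion that is a topological embedding), the sets `ModelWithCorners.boundary/interior`
(`IsManifold/InteriorBoundary.lean`), the half-space model `𝓡∂ n` and the manifold structure on
`Set.Icc (0 : ℝ) 1` (`Instances/Real.lean`), `ModelWithCorners.prod`, `Diffeomorph`. It has no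
collar theorem (0 hits for `collar`), no gluing / pushout of charted spaces and no double of a
manifold: everything below is new. As in G18 (`IsOpenGluing`, Mathlib's `IsLocalization`
pattern) gluings are *relational predicates* on a candidate result `P`, not constructions; the
existence and uniqueness theorems are the sorried theorems of this file.

## Design choices

* `BoundaryData.Collar b` is a *hypothesis structure* (data + properties), general over real
  models `I`, `I₀`; only the existence theorem `BoundaryData.nonempty_collar` is specialised to
  the Euclidean models `𝓡∂ (n + 2)`, `𝓡 (n + 1)`, i.e. to total dimension `≥ 2` (review #7: we
  do not assert a Banach/corners generalisation of the collar theorem; second review #1: in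
  total dimension `1` the structure `Collar` is *empty* for nonempty `∂M`, see the last section
  of this docstring and `Literature.Topology.FourManifolds.isEmpty_collar_closedBallBoundaryData_zero` in
  `Literature.Prelude.FourManL.ClosedBall`).
* `IsClosedGluing IA IB IP R` has the shape of G18's `IsOpenGluing` minus openness of the ranges
  (models explicit and first, types implicit: use `(P := P)`); `IsBoundaryGluing bM bN φ IP P`
  is its instance with the relation "`x = incl z` and `y = incl (φ z)`", and `IsDouble b IP P` is
  `IsBoundaryGluing b b id IP P`.
* The dependence-on-isotopy theorem
  `nonempty_diffeomorph_of_isBoundaryGluing_of_isSmoothlyIsotopic` (outline name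
  `…_of_isIsotopic`) uses `Literature.IsSmoothlyIsotopic (𝓡 n) (𝓡 n) ⇑φ ⇑ψ`: G18's
  `Literature.Topology.FourManifolds.Diffeomorph.IsIsotopic` is *by definition* `IsSmoothlyIsotopic J J ⇑φ ⇑ψ` but is typed for
  self-diffeomorphisms `N ≃ₘ N` only, whereas here `φ ψ : ∂M ≃ₘ ∂N` relate two different types;
  the name follows the hypothesis actually used (Mathlib naming).
* `IsBoundaryGluing.symm` is stated for a bare `Equiv` `φ : ∂M ≃ ∂N` (only `φ.symm` is used);
  the `Diffeomorph` form is `IsBoundaryGluing.symm'`.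
* Universes: `M N : Type u` share the universe of `BoundaryData.carrier : Type u` (fixed by G18),
  the glued manifold `P` is universe polymorphic except in the existence theorem.
* G18's sorried `IsCobordant.trans` / `IsHCobordant.trans` (`Cobordism.lean`) are instances of the
  gluing asserted by `exists_isBoundaryGluing` (glue `W₁ ⊔ W₂` along `N`; Milnor (1965),
  Thm. 1.4); this file does not re-prove them (cross-reference only).

## Why `Manifold.IsSmoothEmbedding (𝓡∂ (n + 1)) (𝓡 (n + 1)) ∞ j` is satisfiable (outline §4.2)

The pieces `M`, `N` of a closed gluing are manifolds *with boundary* embedded in a manifold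
without boundary, and a collar embeds `∂M × [0, 1]` (corners in the model `I₀.prod (𝓡∂ 1)`) into
`M`; boundary points of the source go to points of the target which are interior points, or
boundary points of a different model. Mathlib's immersion predicate is nevertheless satisfiable
there. `Manifold.IsImmersionAt I J n f x` (`Immersion.lean`) lifts the local property
`Manifold.ImmersionAtProp` (`Immersion.lean:137`), which only asks for charts `domChart`,
`codChart` in the *maximal* `C^n` atlases of source and target with
`EqOn ((codChart.extend J) ∘ f ∘ (domChart.extend I).symm) (equiv ∘ (·, 0)) (domChart.extend I).target`
for some continuous linear `equiv : E × F ≃L[ℝ] E'`; the equation is imposed only on the target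
of the extended source chart, i.e. on (a relatively open piece of) the half-space / quadrant.
For a boundary point `x` of the source take any source chart `domChart` at `x` and, `f` being a
local diffeomorphism onto its image in charts (codimension `0`, `F = 0`, or a slice for a collar
restricted to `∂M`), take as `codChart` a target chart in which `f` *is* the chart map near `x`:
the composite `(domChart.extend I) ∘ f⁻¹` extends (by any smooth extension across the boundary
hyperplane, then restriction to an open set on which it stays a diffeomorphism) to a chart of the
target compatible with its `C^∞` atlas, hence lying in the maximal atlas, and in these charts `f`
reads `u ↦ (u, 0)` on `(domChart.extend I).target` with `equiv` the obvious linear isomorphism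
`E × 0 ≃ E`. Thus the requirement is the honest "immersion" condition also at boundary points.
G18's accepted `Cobordism.inl : M → W` uses the same predicate in the analogous direction
`(𝓡 n) → (𝓡∂ (n + 1))` (boundaryless source, target with boundary). Should this reading of
`IsImmersionAt` be contested, the fallback is the elementary form
`ContMDiff ∧ IsEmbedding ∧ ∀ x, Injective (mfderiv …)`, equivalent in these codimension-`0`
compact situations (outline §4.2).

## Why collars are asserted only in total dimension `≥ 2`

The argument above needs room in the model boundary. For a *collar* the source
`∂M × [0, 1]` has model `(𝓡 n).prod (𝓡∂ 1)` and the corner points `(x, ⊤)` (top of the collar)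
are model-boundary points of the source which must go to *interior* points of `M`
(`Collar.apply_mem_interior`, proved below). If `n = 0` the model space `𝔼 0 × 𝔼 1` is
one-dimensional and `range ((𝓡 0).prod (𝓡∂ 1)) = {0} × [0, ∞)` has the single model-boundary
point `0`, so every maximal-atlas chart of the source sends `(x, ⊤)` to `0`, and the *linear*
`equiv` of `Manifold.ImmersionAtProp` forces `codChart.extend (𝓡∂ 1) (c (x, ⊤)) = equiv 0 = 0`,
the model-boundary point of `range (𝓡∂ 1)`: by invariance of the boundary `c (x, ⊤) ∈ ∂M`, a
contradiction. Hence in total dimension `1` the type `b.Collar` is **empty** whenever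
`b.carrier` is nonempty (recorded in the accepted `Literature.Prelude.FourManL.ClosedBall` as
`Literature.Topology.FourManifolds.isEmpty_collar_closedBallBoundaryData_zero` for `M = 𝔻¹`). For `n ≥ 1` the model boundary
hyperplane `𝔼 n × {0}` is positive-dimensional, `(x, ⊤)` can be charted to `(q, 0)` with
`q ≠ 0` and `equiv (q, 0)` chosen in the open half-space, and the obstruction disappears.
Accordingly `BoundaryData.nonempty_collar` is stated for `M` modelled on `𝓡∂ (n + 2)` with
boundary model `𝓡 (n + 1)` (mirroring `Literature.Topology.FourManifolds.nonempty_collar_closedBallBoundaryData`); the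
structure `Collar` itself stays model-general. This costs nothing downstream: gluing and
4-manifold statements only use collars in dimensions `≥ 2`.

Manifold conventions and the local notation `𝔼 n` are those of the accepted G18 files.
-/

open scoped Manifold ContDiff Topology
open Set Function

noncomputable section

namespace Literature.Topology.FourManifolds

universe u

/-- Local notation: `𝔼 n` is the model Euclidean space `EuclideanSpace ℝ (Fin n)`. -/
local notation "𝔼 " n:arg => EuclideanSpace ℝ (Fin n)

/-! ### Collars -/

section Collar

variable {E H E₀ H₀ : Type*} [NormedAddCommGroup E] [NormedSpace ℝ E] [TopologicalSpace H]
  [NormedAddCommGroup E₀] [NormedSpace ℝ E₀] [TopologicalSpace H₀]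
  {I : ModelWithCorners ℝ E H} {M : Type u} [TopologicalSpace M] [ChartedSpace H M]
  {I₀ : ModelWithCorners ℝ E₀ H₀}

/-- A (closed) *collar* of a boundary datum `b` of `M`: a smooth embedding
`toFun : b.carrier × [0, 1] → M` (source model `I₀.prod (𝓡∂ 1)`) whose restriction to
`b.carrier × [0, 1)` has open image and which restricts to the boundary inclusion `b.incl` on
`b.carrier × {0}`. Hirsch, *Differential Topology* (1976), §4.6 (collar on `∂M`); Milnor,
*Lectures on the h-cobordism theorem* (1965), §1 ("collar neighbourhood"). Existence for smooth
manifolds with boundary of dimension `≥ 2` is `Literature.Topology.FourManifolds.BoundaryData.nonempty_collar`; in total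
dimension `1` (`I₀.prod (𝓡∂ 1)` with `0`-dimensional `I₀`) this type is empty for nonempty
`b.carrier`, because the linear `equiv` in `Manifold.ImmersionAtProp` pins the corner `(x, ⊤)`
to the model boundary (see the module docstring and
`Literature.Topology.FourManifolds.isEmpty_collar_closedBallBoundaryData_zero`). [folklore] -/
structure BoundaryData.Collar (b : BoundaryData I M I₀) where
  /-- The collar map `∂M × [0, 1] → M`. -/
  toFun : b.carrier × Set.Icc (0 : ℝ) 1 → M
  /-- The collar map is a smooth embedding (for the product model with corners). -/
  isSmoothEmbedding : Manifold.IsSmoothEmbedding (I₀.prod (𝓡∂ 1)) I ∞ toFun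
  /-- The image of the half-open collar `∂M × [0, 1)` is open in `M`. -/
  isOpen_image : IsOpen (toFun '' {p | (p.2 : ℝ) < 1})
  /-- On `∂M × {0}` the collar is the boundary inclusion. -/
  apply_bot : ∀ x, toFun (x, ⊥) = b.incl x

namespace BoundaryData.Collar

variable {b : BoundaryData I M I₀}

/-- A collar is used as a function `b.carrier × [0, 1] → M` (the coercion unfolds to `toFun`
syntactically, so no `toFun_eq_coe` lemma is needed). [folklore] -/
instance : CoeFun b.Collar (fun _ => b.carrier × Set.Icc (0 : ℝ) 1 → M) := ⟨toFun⟩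

/-- A collar is continuous (it is a topological embedding). Hirsch (1976), §4.6. [cite: Hirsch1976] -/
protected theorem continuous (c : b.Collar) : Continuous c :=
  c.isSmoothEmbedding.isEmbedding.continuous

/-- A collar is injective (it is a topological embedding). Hirsch (1976), §4.6. [cite: Hirsch1976] -/
protected theorem injective (c : b.Collar) : Injective c :=
  c.isSmoothEmbedding.isEmbedding.injective

/-- The bottom `∂M × {0}` of a collar lies in the boundary `∂M`. Hirsch (1976), §4.6. [cite: Hirsch1976] -/
theorem apply_bot_mem_boundary (c : b.Collar) (x : b.carrier) : c (x, ⊥) ∈ I.boundary M := by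
  rw [c.apply_bot]
  exact b.incl_mem_boundary x

/-- Away from the bottom, a collar lies in the interior of `M`: `c (x, t) ∈ Int M` for `0 < t`
(the boundary is exactly `range b.incl = c '' (∂M × {0})` and `c` is injective).
Hirsch (1976), §4.6. [cite: Hirsch1976] -/
theorem apply_mem_interior (c : b.Collar) (x : b.carrier) {t : Set.Icc (0 : ℝ) 1} (ht : ⊥ < t) :
    c (x, t) ∈ I.interior M := by
  rw [← ModelWithCorners.compl_boundary, mem_compl_iff, ← b.range_incl]
  rintro ⟨y, hy⟩
  rw [← c.apply_bot] at hy
  have h := congrArg Prod.snd (c.injective hy)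
  exact ht.ne h

end BoundaryData.Collar

/-- **Collar neighbourhood theorem** (Euclidean specialisation, dimension `≥ 2`). The boundary
of a smooth `(n+2)`-manifold with boundary `M` (Hausdorff, second countable, model
`𝓡∂ (n + 2)`) admits a collar: for every boundary datum `b` (model `𝓡 (n + 1)`) there is a
smooth embedding `b.carrier × [0, 1] ↪ M` extending `b.incl` with open image of
`b.carrier × [0, 1)`. M. Brown, Ann. Math. 75 (1962) (topological version); Hirsch,
*Differential Topology* (1976), Thm. 4.6.1; Milnor, *Lectures on the h-cobordism theorem*
(1965), §1. Absent from Mathlib. Only the finite-dimensional Euclidean case is asserted (the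
structure `Collar` is general), and only in total dimension `≥ 2`: for `1`-manifolds with
nonempty boundary `b.Collar` is empty (Mathlib's linear immersion property at the corner
`(x, ⊤)`; see the module docstring and `Literature.Topology.FourManifolds.isEmpty_collar_closedBallBoundaryData_zero`), so the
dimension shift is necessary, not a loss of generality within this formalisation.
[cite: HirschDT1976, Thm. 4.6.1] -/
def BoundaryData.nonempty_collar : Prop :=
  ∀ (n : ℕ) (M : Type u) [TopologicalSpace M] [T2Space M] [SecondCountableTopology M] [ChartedSpace (EuclideanHalfSpace (n + 2)) M] [IsManifold (𝓡∂ (n + 2)) ∞ M] (b : BoundaryData (𝓡∂ (n + 2)) M (𝓡 (n + 1))),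
    Nonempty b.Collar

end Collar

/-! ### Closed gluings -/

section ClosedGluing

variable {EA HA EB HB EP HP : Type*}
  [NormedAddCommGroup EA] [NormedSpace ℝ EA] [TopologicalSpace HA] (IA : ModelWithCorners ℝ EA HA)
  [NormedAddCommGroup EB] [NormedSpace ℝ EB] [TopologicalSpace HB] (IB : ModelWithCorners ℝ EB HB)
  [NormedAddCommGroup EP] [NormedSpace ℝ EP] [TopologicalSpace HP] (IP : ModelWithCorners ℝ EP HP)
  {A B P : Type*} [TopologicalSpace A] [ChartedSpace HA A] [TopologicalSpace B]
  [ChartedSpace HB B] [TopologicalSpace P] [ChartedSpace HP P]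

/-- **Closed gluing.** The manifold `P` is obtained by gluing `A` and `B` along the relation
`R : A → B → Prop`: there are smooth (`C^∞`) embeddings `jA : A → P`, `jB : B → P` whose ranges
cover `P` and such that `jA a = jB b` holds exactly when `R a b`. As a set `P` is the pushout of
`A ← {(a, b) | R a b} → B`. This is G18's `Literature.Topology.FourManifolds.IsOpenGluing` without openness of the ranges: the
intended use is for compact pieces `A`, `B` with boundary (model `𝓡∂ (n + 1)`) embedded as
codimension-`0` submanifolds of a manifold `P` without boundary and meeting along their
boundaries (Hirsch, *Differential Topology* (1976), §8.2; Bröcker–Jänich (1982), §13). No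
`IsManifold` hypothesis is imposed (only `ChartedSpace`); consumers add what they need. [cite: BrockerJanich1982] -/
def IsClosedGluing (R : A → B → Prop) : Prop :=
  ∃ (jA : A → P) (jB : B → P), Manifold.IsSmoothEmbedding IA IP ∞ jA ∧
    Manifold.IsSmoothEmbedding IB IP ∞ jB ∧ range jA ∪ range jB = univ ∧
    ∀ a b, jA a = jB b ↔ R a b

variable {IA IB IP}

/-- A closed gluing of `A` and `B` along `R` is a closed gluing of `B` and `A` along the swapped
relation. Hirsch (1976), §8.2. [cite: Hirsch1976] -/
theorem IsClosedGluing.symm {R : A → B → Prop} (h : IsClosedGluing IA IB IP (P := P) R) :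
    IsClosedGluing IB IA IP (P := P) (Function.swap R) := by
  obtain ⟨jA, jB, hA, hB, hU, hR⟩ := h
  refine ⟨jB, jA, hB, hA, (union_comm _ _).trans hU, fun b a => ?_⟩
  rw [eq_comm]
  exact hR a b

/-- Closed gluings along pointwise equivalent relations agree. [folklore] -/
theorem IsClosedGluing.congr {R R' : A → B → Prop} (h : IsClosedGluing IA IB IP (P := P) R)
    (hRR' : ∀ a b, R a b ↔ R' a b) : IsClosedGluing IA IB IP (P := P) R' := by
  obtain ⟨jA, jB, hA, hB, hU, hR⟩ := h
  exact ⟨jA, jB, hA, hB, hU, fun a b => (hR a b).trans (hRR' a b)⟩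

/-- The result of a closed gluing of two compact pieces is compact (it is the union of the two
continuous images). Hirsch (1976), §8.2. [cite: Hirsch1976] -/
theorem IsClosedGluing.compactSpace [CompactSpace A] [CompactSpace B] {R : A → B → Prop}
    (h : IsClosedGluing IA IB IP (P := P) R) : CompactSpace P := by
  obtain ⟨jA, jB, hA, hB, hU, -⟩ := h
  refine ⟨?_⟩
  rw [← hU]
  exact (isCompact_range hA.isEmbedding.continuous).union
    (isCompact_range hB.isEmbedding.continuous)

end ClosedGluing

/-! ### Gluing along the boundary -/

section BoundaryGluing

variable {EM HM EN HN E₀ H₀ E₀' H₀' EP HP : Type*}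
  [NormedAddCommGroup EM] [NormedSpace ℝ EM] [TopologicalSpace HM] {IM : ModelWithCorners ℝ EM HM}
  [NormedAddCommGroup EN] [NormedSpace ℝ EN] [TopologicalSpace HN] {IN : ModelWithCorners ℝ EN HN}
  [NormedAddCommGroup E₀] [NormedSpace ℝ E₀] [TopologicalSpace H₀] {I₀ : ModelWithCorners ℝ E₀ H₀}
  [NormedAddCommGroup E₀'] [NormedSpace ℝ E₀'] [TopologicalSpace H₀']
  {I₀' : ModelWithCorners ℝ E₀' H₀'}
  [NormedAddCommGroup EP] [NormedSpace ℝ EP] [TopologicalSpace HP]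
  {M : Type u} [TopologicalSpace M] [ChartedSpace HM M]
  {N : Type u} [TopologicalSpace N] [ChartedSpace HN N]

/-- **Gluing along the boundary**, "`P = M ∪_φ N`". Given boundary data `bM` of `M` and `bN` of
`N` and a map `φ : ∂M → ∂N` (a diffeomorphism in every use), the charted space `P` (model `IP`)
*is the gluing of `M` and `N` along `φ`* if it is a closed gluing of `M` and `N` along the
relation identifying `bM.incl z` with `bN.incl (φ z)` for `z : ∂M`: `M` and `N` are smoothly
embedded in `P` as pieces covering `P` and meeting exactly along `∂M ≡_φ ∂N`.
Hirsch, *Differential Topology* (1976), §8.2 ("`M ∪_f N`"); Bröcker–Jänich, *Introduction to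
Differential Topology* (1982), §13; Milnor, *Lectures on the h-cobordism theorem* (1965), §1.
Existence and uniqueness (Euclidean case) are `Literature.Topology.FourManifolds.exists_isBoundaryGluing` and
`Literature.Topology.FourManifolds.nonempty_diffeomorph_of_isBoundaryGluing`. [folklore] -/
def IsBoundaryGluing (bM : BoundaryData IM M I₀) (bN : BoundaryData IN N I₀')
    (φ : bM.carrier → bN.carrier) (IP : ModelWithCorners ℝ EP HP) (P : Type*)
    [TopologicalSpace P] [ChartedSpace HP P] : Prop :=
  IsClosedGluing IM IN IP (P := P) fun x y => ∃ z, x = bM.incl z ∧ y = bN.incl (φ z)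

/-- **The double** `D M = M ∪_{id} M` of a manifold with boundary: `P` is the gluing of two
copies of `M` along the identity of `∂M`. Hirsch (1976), §8.2, Example; Bröcker–Jänich (1982),
§13; Munkres, *Elementary Differential Topology* (1966), §6 (Thm. 6.3). [cite: Hirsch1976] -/
def IsDouble (b : BoundaryData IM M I₀) (IP : ModelWithCorners ℝ EP HP) (P : Type*)
    [TopologicalSpace P] [ChartedSpace HP P] : Prop :=
  IsBoundaryGluing b b id IP P

variable {bM : BoundaryData IM M I₀} {bN : BoundaryData IN N I₀'} {IP : ModelWithCorners ℝ EP HP}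
  {P : Type*} [TopologicalSpace P] [ChartedSpace HP P]

/-- A gluing along the boundary is in particular a closed gluing (definitional unfolding). [folklore] -/
theorem IsBoundaryGluing.isClosedGluing {φ : bM.carrier → bN.carrier}
    (h : IsBoundaryGluing bM bN φ IP P) :
    IsClosedGluing IM IN IP (P := P) fun x y => ∃ z, x = bM.incl z ∧ y = bN.incl (φ z) :=
  h

/-- `M ∪_φ N` is also `N ∪_{φ⁻¹} M`: gluing along the boundary is symmetric up to inverting the
gluing diffeomorphism. Hirsch (1976), §8.2. [cite: Hirsch1976] -/
theorem IsBoundaryGluing.symm {φ : bM.carrier ≃ bN.carrier}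
    (h : IsBoundaryGluing bM bN φ IP P) : IsBoundaryGluing bN bM φ.symm IP P := by
  refine (IsClosedGluing.symm h).congr fun y x => ?_
  simp only [Function.swap]
  constructor
  · rintro ⟨z, hx, hy⟩
    exact ⟨φ z, hy, by simpa using hx⟩
  · rintro ⟨w, hy, hx⟩
    exact ⟨φ.symm w, hx, by simpa using hy⟩

/-- `M ∪_φ N` is also `N ∪_{φ⁻¹} M`, for a gluing diffeomorphism `φ` (the form used downstream;
`IsBoundaryGluing.symm` is the version for a bare bijection). Hirsch (1976), §8.2. [cite: Hirsch1976] -/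
theorem IsBoundaryGluing.symm' {φ : bM.carrier ≃ₘ⟮I₀, I₀'⟯ bN.carrier}
    (h : IsBoundaryGluing bM bN φ IP P) : IsBoundaryGluing bN bM φ.symm IP P :=
  IsBoundaryGluing.symm (φ := φ.toEquiv) h

/-- Gluing two compact manifolds along their boundary yields a compact manifold.
Hirsch (1976), §8.2. [cite: Hirsch1976] -/
theorem IsBoundaryGluing.compactSpace [CompactSpace M] [CompactSpace N]
    {φ : bM.carrier → bN.carrier} (h : IsBoundaryGluing bM bN φ IP P) : CompactSpace P :=
  IsClosedGluing.compactSpace h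

/-- A double `D M` is the gluing `M ∪_{id} M` (definitional unfolding of `IsDouble`). [folklore] -/
theorem IsDouble.isBoundaryGluing {b : BoundaryData IM M I₀} (h : IsDouble b IP P) :
    IsBoundaryGluing b b id IP P :=
  h

end BoundaryGluing

/-! ### Existence and uniqueness of gluings (Euclidean case) -/

section Euclidean

variable {n : ℕ} {M N : Type u} [TopologicalSpace M] [T2Space M] [SecondCountableTopology M]
  [ChartedSpace (EuclideanHalfSpace (n + 1)) M] [IsManifold (𝓡∂ (n + 1)) ∞ M] [CompactSpace M]
  [TopologicalSpace N] [T2Space N] [SecondCountableTopology N]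
  [ChartedSpace (EuclideanHalfSpace (n + 1)) N] [IsManifold (𝓡∂ (n + 1)) ∞ N] [CompactSpace N]
  {bM : BoundaryData (𝓡∂ (n + 1)) M (𝓡 n)} {bN : BoundaryData (𝓡∂ (n + 1)) N (𝓡 n)}
  {P P' : Type u} [TopologicalSpace P] [ChartedSpace (𝔼 (n + 1)) P]
  [IsManifold (𝓡 (n + 1)) ∞ P] [TopologicalSpace P'] [ChartedSpace (𝔼 (n + 1)) P']
  [IsManifold (𝓡 (n + 1)) ∞ P']

variable (bM bN) in
/-- **Existence of the gluing `M ∪_φ N`.** For compact smooth `(n+1)`-manifolds with boundary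
`M`, `N` and a diffeomorphism `φ : ∂M ≅ ∂N` of their boundaries there is a compact Hausdorff
second-countable smooth `(n+1)`-manifold without boundary `P` which is the gluing of `M` and
`N` along `φ` (constructed with collars of `∂M`, `∂N`). Hirsch, *Differential Topology* (1976),
Thm. 8.2.1; Bröcker–Jänich (1982), §13 (13.11); Milnor (1965), §1, Thm. 1.4 (of which G18's
sorried `Literature.Topology.FourManifolds.IsCobordant.trans` is an instance). Absent from Mathlib. [cite: BrockerJanich1982] -/
def exists_isBoundaryGluing : Prop :=
  ∀ (φ : bM.carrier ≃ₘ⟮𝓡 n, 𝓡 n⟯ bN.carrier),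
    ∃ (P : Type u) (_ : TopologicalSpace P) (_ : T2Space P) (_ : SecondCountableTopology P)
      (_ : CompactSpace P) (_ : ChartedSpace (𝔼 (n + 1)) P) (_ : IsManifold (𝓡 (n + 1)) ∞ P),
      IsBoundaryGluing bM bN φ (𝓡 (n + 1)) P

/-- **Uniqueness of the gluing.** Two smooth manifolds which are both the gluing of `M` and `N`
along the same diffeomorphism `φ : ∂M ≅ ∂N` are diffeomorphic (uniqueness of collars up to
isotopy). Hirsch, *Differential Topology* (1976), Thm. 8.2.1 (well-definedness of the smooth
structure on `M ∪_φ N`); Bröcker–Jänich (1982), §13. [cite: BrockerJanich1982] -/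
def nonempty_diffeomorph_of_isBoundaryGluing : Prop :=
  ∀ {φ : bM.carrier ≃ₘ⟮𝓡 n, 𝓡 n⟯ bN.carrier} (hP : IsBoundaryGluing bM bN φ (𝓡 (n + 1)) P) (hP' : IsBoundaryGluing bM bN φ (𝓡 (n + 1)) P'),
    Nonempty (P ≃ₘ⟮𝓡 (n + 1), 𝓡 (n + 1)⟯ P')

/-- **The gluing depends only on the isotopy class of `φ`.** If `φ, ψ : ∂M ≅ ∂N` are smoothly
isotopic diffeomorphisms then `M ∪_φ N ≅ M ∪_ψ N`. Hirsch, *Differential Topology* (1976),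
Thm. 8.2.2. The hypothesis is `Literature.IsSmoothlyIsotopic (𝓡 n) (𝓡 n) ⇑φ ⇑ψ`, the relation
underlying G18's `Literature.Topology.FourManifolds.Diffeomorph.IsIsotopic` (which is typed for self-diffeomorphisms only);
for diffeomorphisms of compact manifolds a smooth isotopy through smooth maps can be taken
through diffeomorphisms, so this is Hirsch's hypothesis. (Outline name:
`nonempty_diffeomorph_of_isBoundaryGluing_of_isIsotopic`; renamed after the hypothesis.)
[cite: HirschDT1976, Thm. 8.2.2] -/
def nonempty_diffeomorph_of_isBoundaryGluing_of_isSmoothlyIsotopic : Prop :=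
  ∀ {φ ψ : bM.carrier ≃ₘ⟮𝓡 n, 𝓡 n⟯ bN.carrier} (h : IsSmoothlyIsotopic (𝓡 n) (𝓡 n) ⇑φ ⇑ψ) (hP : IsBoundaryGluing bM bN φ (𝓡 (n + 1)) P) (hP' : IsBoundaryGluing bM bN ψ (𝓡 (n + 1)) P'),
    Nonempty (P ≃ₘ⟮𝓡 (n + 1), 𝓡 (n + 1)⟯ P')

end Euclidean

end Literature.Topology.FourManifolds
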